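import Summits.CriticalPhenomena.SAWScalingLimit.Theorems.BoundaryTP2Negative_Box3
import HarnessLib

/-!
# Negative knowledge on crux `BoundaryTP2`, part 4: interlacing is load-bearing

**`boundaryTP2_false_without_interlacing`**: `BoundaryTP2` (item stmt-CriticalPhenomena-7115) with its
interlacing hypothesis (i) dropped — everything else verbatim — is FALSE (stated under the quoted bounds
`2.6 ≤ μ ≤ 2.7`, `SAW.LawlerSchrammWerner2004SAW_connectiveConstant_bounds`, which the tree discharges
computationally in `SelfAvoidingWalkCert.lean`; only `x_c ≤ 5/13` is used).  Witness: the 3 × 3 box `Ω₃`,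
`p = ((0,0),(1,1),(0,1),(2,1))`; both disjoint-realisability hypotheses hold, and
`Z(p₁,p₃)Z(p₂,p₄) ≥ x_c² > (2x_c²+2x_c⁴+2x_c⁶+2x_c⁸)(x_c²+6x_c⁴+2x_c⁶) = Z(p₁,p₂)Z(p₃,p₄)` for `x_c ≤ 5/13`
(certified complete enumeration, part 3).  Found by exhaustive search over all site animals ≤ 12 sites; the
same search shows hypotheses (ii),(iii) are never needed on those instances. [folklore]
-/

namespace Summit.CriticalPhenomena.SAWScalingLimit.Theorems.BoundaryTP2.Negative

open Literature.Probability.LatticeModels Literature.Probability.RandomPlanarGeometry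
open scoped ENNReal

section Box3

/-- The certified polynomial inequality behind the witness: for `0 < x ≤ 5/13`,
`(2x²+2x⁴+2x⁶+2x⁸)(x²+6x⁴+2x⁶) < x²` (in the list form produced by the enumeration). [folklore] -/
theorem poly_ineq {x : ℝ} (hx0 : 0 < x) (hx1 : x ≤ 5 / 13) :
    ([4, 8, 6, 2, 2, 6, 8, 4].map fun k : ℕ => x ^ k).sum * ([2, 4, 4, 4, 4, 6, 4, 4, 6].map fun k : ℕ => x ^ k).sum
      < x * x := by
  simp only [List.map_cons, List.map_nil, List.sum_cons, List.sum_nil, add_zero]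
  set t := x ^ 2 with ht
  have ht0 : 0 < t := by positivity
  have ht1 : t ≤ 25 / 169 := by rw [ht]; nlinarith
  have e4 : x ^ 4 = t ^ 2 := by rw [ht]; ring
  have e6 : x ^ 6 = t ^ 3 := by rw [ht]; ring
  have e8 : x ^ 8 = t ^ 4 := by rw [ht]; ring
  have exx : x * x = t := by rw [ht]; ring
  rw [e4, e6, e8, exx]
  have t2 : t ^ 2 ≤ (25 / 169) ^ 2 := by gcongr
  have t3 : t ^ 3 ≤ (25 / 169) ^ 3 := by gcongr
  have t4 : t ^ 4 ≤ (25 / 169) ^ 4 := by gcongr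
  have hA : t ^ 2 + (t ^ 4 + (t ^ 3 + (t + (t + (t ^ 3 + (t ^ 4 + t ^ 2)))))) ≤ 12 / 5 * t := by nlinarith
  have hB : t + (t ^ 2 + (t ^ 2 + (t ^ 2 + (t ^ 2 + (t ^ 3 + (t ^ 2 + (t ^ 2 + t ^ 3))))))) ≤ 2 * t := by nlinarith
  have hA0 : 0 ≤ t ^ 2 + (t ^ 4 + (t ^ 3 + (t + (t + (t ^ 3 + (t ^ 4 + t ^ 2)))))) := by positivity
  calc _ ≤ (12 / 5 * t) * (2 * t) := mul_le_mul hA hB (by positivity) (by positivity)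
    _ = (24 / 5 * t) * t := by ring
    _ < 1 * t := by
        apply mul_lt_mul_of_pos_right _ ht0
        nlinarith
    _ = t := one_mul t

/-- **Interlacing is load-bearing**: `BoundaryTP2` without hypothesis (i) is FALSE (3 × 3 box,
`p = ((0,0),(1,1),(0,1),(2,1))`). [folklore] -/
theorem boundaryTP2_false_without_interlacing (hμ : SAW.LawlerSchrammWerner2004SAW_connectiveConstant_bounds) : ¬ (
  ∀ (Ω : Set ℂ) (δ : ℝ) (p₁ p₂ p₃ p₄ : Site 2), Bornology.IsBounded Ω → SimplyConnectedSpace Ω → 0 < δ →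
      (∃ (P : SAW.DomainSAW Ω δ p₁ p₂) (Q : SAW.DomainSAW Ω δ p₃ p₄), List.Disjoint P.walk.support Q.walk.support) →
      (∃ (P : SAW.DomainSAW Ω δ p₁ p₄) (Q : SAW.DomainSAW Ω δ p₂ p₃), List.Disjoint P.walk.support Q.walk.support) →
      SAW.weight Ω δ p₁ p₃ Set.univ * SAW.weight Ω δ p₂ p₄ Set.univ ≤
        SAW.weight Ω δ p₁ p₂ Set.univ * SAW.weight Ω δ p₃ p₄ Set.univ) := by
  intro h
  have hle := h Ω₃ 1 ![0, 0] ![1, 1] ![0, 1] ![2, 1] isBounded_Ω₃ simplyConnectedSpace_Ω₃ one_pos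
    ⟨P₁, Q₁, by simp [P₁, Q₁]⟩ ⟨P₂, Q₂, by simp [P₂, Q₂]⟩
  have hx := SAW.criticalFugacity_pos_lt_one hμ
  have hx1 : SAW.criticalFugacity ≤ 5 / 13 := by
    rw [SAW.criticalFugacity]
    have h26 := hμ.1
    rw [inv_le_comm₀ (by linarith) (by norm_num)]
    norm_num
    linarith
  have hlt : SAW.weight Ω₃ 1 ![0, 0] ![1, 1] Set.univ * SAW.weight Ω₃ 1 ![0, 1] ![2, 1] Set.univ <
      SAW.weight Ω₃ 1 ![0, 0] ![0, 1] Set.univ * SAW.weight Ω₃ 1 ![1, 1] ![2, 1] Set.univ := by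
    calc _ ≤ _ := mul_le_mul' weight_00_11_le weight_01_21_le
      _ = ENNReal.ofReal (([4, 8, 6, 2, 2, 6, 8, 4].map fun k : ℕ => SAW.criticalFugacity ^ k).sum *
            ([2, 4, 4, 4, 4, 6, 4, 4, 6].map fun k : ℕ => SAW.criticalFugacity ^ k).sum) := by
          rw [ENNReal.ofReal_mul]
          exact List.sum_nonneg (fun t ht => by
            rw [List.mem_map] at ht
            obtain ⟨m, -, rfl⟩ := ht
            exact pow_nonneg hx.1.le m)
      _ < ENNReal.ofReal (SAW.criticalFugacity * SAW.criticalFugacity) := by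
          rw [ENNReal.ofReal_lt_ofReal_iff (mul_pos hx.1 hx.1)]
          exact poly_ineq hx.1 hx1
      _ = ENNReal.ofReal SAW.criticalFugacity * ENNReal.ofReal SAW.criticalFugacity :=
          ENNReal.ofReal_mul hx.1.le
      _ ≤ _ := mul_le_mul' le_weight_00_01 le_weight_11_21
  exact absurd hle (not_le.2 hlt)


end Box3

end Summit.CriticalPhenomena.SAWScalingLimit.Theorems.BoundaryTP2.Negative
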